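import Summits.Ventures.Crystal3D.Theorems.StickyWulffConstantNoReconstructionGainExactThinNoCriminal
import Summits.Ventures.Crystal3D.Theorems.StickyWulffConstantNoReconstructionGainExactFilmAboveCutAll
import Summits.Ventures.Crystal3D.Theorems.StickyWulffConstantNoReconstructionGainLayerCover
import HarnessLib

/-!
# A `(111)` criminal reaches beyond the first adsorbed layer (line `replication-exactness`)

HONEST FRAMING. Part of the venture `Summits/Ventures/Crystal3D` (cell `crystal3d-full`), supports the
crux `NoReconstructionGain` (stmt-Ventures-19144, route `route-Ventures-StickyWulffConstant`), line
`replication-exactness` (lead wulff-p1 g18).  Corollary of the thin-film exclusion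
(`not_isCriminal_of_thin_offLattice`, `…ExactThinNoCriminal`) on the basal face: over the
close-packed layer `k` of `Λ₀` (height `k√(2/3)`, normal `e₃`) every ball of a film lies at height
`≥ (k+1)√(2/3)` (covering radius `1/√3` of the layer, `hollow_height_sq`, and films lie strictly
above the cut, `IsFilmOn.lt_inner`); so if all OFF-LATTICE balls lie below
`(k+1)√(2/3) + 1/4` the off-lattice part is `1/4`-thin along `e₃`.

* `le_height_of_isFilmOn_basal` — on `H(e₃, s)` with `k√(2/3) ≤ s`, every film ball has third
  coordinate `≥ (k+1)√(2/3)`;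
* `not_isCriminal_basal_of_low_offLattice` — **no `(111)` criminal within the first adsorbed
  layer**: if every off-lattice ball has height `≤ (k+1)√(2/3) + 1/4` (all hollow / bridge / atop
  adsorption positions over the terrace have height `≤ k√(2/3) + 1 < (k+1)√(2/3) + 1/4`), the film
  is not a criminal on `H(e₃, s)`;
* `exists_unplugged_offLattice_of_criminal_basal` — on `H(e₃, s)` with top layer `k`
  (`k√(2/3) ≤ s < (k+1)√(2/3)`) every criminal has an off-lattice ball touching NO substrate site.

WHAT THIS IS NOT: other faces; the crux; rung F-C1 not moved.
-/

noncomputable section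

namespace Summit.Ventures.Crystal3D.Theorems

open Summit.Ventures.Crystal3D
open Literature.MathematicalPhysics.StatisticalMechanics (fccStacking barlowPos barlowPos_mem
  barlowPos_apply_two constHagg)
open scoped InnerProductSpace
open Finset

/-- The third coordinate is the `e₃`-height. -/
private theorem inner_e3 (v : EuclideanSpace ℝ (Fin 3)) :
    ⟪v, EuclideanSpace.single 2 (1 : ℝ)⟫_ℝ = v 2 := by
  rw [EuclideanSpace.inner_single_right]; simp

/-- **Film balls over a close-packed layer sit at least one layer spacing higher.** -/
theorem le_height_of_isFilmOn_basal (k : ℤ) {s : ℝ} (hs : (k : ℝ) * Real.sqrt (2 / 3) ≤ s)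
    {Q : Finset (EuclideanSpace ℝ (Fin 3))} (hQ : IsFilmOn (EuclideanSpace.single 2 (1 : ℝ)) s Q)
    {q : EuclideanSpace ℝ (Fin 3)} (hq : q ∈ Q) :
    ((k : ℝ) + 1) * Real.sqrt (2 / 3) ≤ q 2 := by
  have he : ‖(EuclideanSpace.single 2 (1 : ℝ) : EuclideanSpace ℝ (Fin 3))‖ = 1 := by
    rw [PiLp.norm_single, norm_one]
  -- the covering site of layer `k` under `q`
  obtain ⟨i, j, hcov⟩ := exists_fccSite_planar_sq_le_third (q 0) (q 1) k
  have hsite : barlowPos 1 (Real.sqrt (2 / 3)) constHagg k i j ∈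
      halfCrystal (EuclideanSpace.single 2 (1 : ℝ)) s := by
    refine ⟨barlowPos_mem k i j, ?_⟩
    rw [inner_e3, barlowPos_apply_two]; exact hs
  have hfar := hQ.2 q hq _ hsite
  have hsq := hollow_height_sq q k i j hcov hfar
  have habove : s < q 2 := by
    have := IsFilmOn.lt_inner he hQ hq; rwa [inner_e3] at this
  have hpos : 0 < q 2 - (k : ℝ) * Real.sqrt (2 / 3) := by linarith
  have h23 : Real.sqrt (2 / 3) ≤ q 2 - (k : ℝ) * Real.sqrt (2 / 3) := by
    rw [← Real.sqrt_sq hpos.le]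
    exact Real.sqrt_le_sqrt hsq
  linarith

/-- **No `(111)` criminal within the first adsorbed layer.** -/
theorem not_isCriminal_basal_of_low_offLattice (k : ℤ) {s : ℝ} (hs : (k : ℝ) * Real.sqrt (2 / 3) ≤ s)
    {Q : Finset (EuclideanSpace ℝ (Fin 3))}
    (hlow : ∀ q ∈ Q, q ∉ fccStacking 1 (Real.sqrt (2 / 3)) →
      q 2 ≤ ((k : ℝ) + 1) * Real.sqrt (2 / 3) + 1 / 4) :
    ¬ IsCriminal (EuclideanSpace.single 2 (1 : ℝ)) s Q := by
  intro hcrim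
  have he : ‖(EuclideanSpace.single 2 (1 : ℝ) : EuclideanSpace ℝ (Fin 3))‖ = 1 := by
    rw [PiLp.norm_single, norm_one]
  refine not_isCriminal_of_thin_offLattice (EuclideanSpace.single 2 (1 : ℝ)) he
    (fun x hx y hy hxΛ hyΛ => ?_) hcrim
  rw [inner_e3, PiLp.sub_apply, abs_le]
  have h1 := le_height_of_isFilmOn_basal k hs hcrim.1 hx
  have h2 := le_height_of_isFilmOn_basal k hs hcrim.1 hy
  have h3 := hlow x hx hxΛ
  have h4 := hlow y hy hyΛ
  constructor <;> linarith

/-- **On `(111)` every criminal has an UNPLUGGED off-lattice ball** (an off-lattice ball touching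
no substrate site): a plugged ball over the top layer `k` has height `≤ k√(2/3) + 1 <
(k+1)√(2/3) + 1/4`, so if all off-lattice balls were plugged the film would lie within the first
adsorbed layer. -/
theorem exists_unplugged_offLattice_of_criminal_basal (k : ℤ) {s : ℝ}
    (hs : (k : ℝ) * Real.sqrt (2 / 3) ≤ s) (hs' : s < ((k : ℝ) + 1) * Real.sqrt (2 / 3))
    {Q : Finset (EuclideanSpace ℝ (Fin 3))} (hQ : IsCriminal (EuclideanSpace.single 2 (1 : ℝ)) s Q) :
    ∃ q ∈ Q, q ∉ fccStacking 1 (Real.sqrt (2 / 3)) ∧ plugSet (EuclideanSpace.single 2 (1 : ℝ)) s q = ∅ := by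
  by_contra hall
  push Not at hall
  have h23 : Real.sqrt (2 / 3) ^ 2 = 2 / 3 := Real.sq_sqrt (by norm_num)
  have h23' : 3 / 4 ≤ Real.sqrt (2 / 3) := by nlinarith [Real.sqrt_nonneg (2 / 3), h23]
  refine not_isCriminal_basal_of_low_offLattice k hs (fun q hq hqΛ => ?_) hQ
  obtain ⟨p, ⟨hpΛ, hps⟩, hpd⟩ := hall q hq hqΛ
  -- the plug lies in a layer `k' ≤ k`
  obtain ⟨k', i, j, rfl⟩ := hpΛ
  rw [inner_e3, barlowPos_apply_two] at hps
  have hk' : (k' : ℝ) * Real.sqrt (2 / 3) ≤ (k : ℝ) * Real.sqrt (2 / 3) := by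
    have hlt : (k' : ℝ) * Real.sqrt (2 / 3) < ((k : ℝ) + 1) * Real.sqrt (2 / 3) := hps.trans_lt hs'
    have hpos : 0 < Real.sqrt (2 / 3) := Real.sqrt_pos.2 (by norm_num)
    have h1 : (k' : ℝ) < k + 1 := lt_of_mul_lt_mul_right hlt hpos.le
    have h2 : k' < k + 1 := by exact_mod_cast h1
    have h3 : (k' : ℝ) ≤ k := by exact_mod_cast Int.lt_add_one_iff.1 h2
    exact mul_le_mul_of_nonneg_right h3 hpos.le
  -- the ball is at most `1` above its plug
  have hqp : q 2 - barlowPos 1 (Real.sqrt (2 / 3)) constHagg k' i j 2 ≤ 1 := by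
    have h1 := real_inner_le_norm (q - barlowPos 1 (Real.sqrt (2 / 3)) constHagg k' i j)
      (EuclideanSpace.single 2 (1 : ℝ))
    rw [inner_e3, PiLp.sub_apply, PiLp.norm_single, norm_one, mul_one, ← dist_eq_norm, hpd] at h1
    exact h1
  rw [barlowPos_apply_two] at hqp
  linarith

end Summit.Ventures.Crystal3D.Theorems

end
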